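import Mathlib.Analysis.Complex.Isometry
import Mathlib.Analysis.Complex.Circle
import Mathlib.Topology.MetricSpace.HausdorffDistance
import Literature.Probability.LatticeModels.CellGridSaddlePercolation
import Literature.Probability.Percolation.SiteConnectionTools
import Literature.Probability.RandomPlanarGeometry.ChordalCurveFamily
import HarnessLib

/-!
# `D₄`-covariance of the cell-grid crossing events

Topic `Literature/Probability/LatticeModels` (definition item `defn-CellGridSaddlePercolation`,
companion of `CellGridSaddlePercolation.lean`; needed verbatim by hypothesis (a) of
`AnchorByRigidity` in route `CardyIKTransport`: "the same `δ → 0⁺` limits on `R` and on its quarter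
turn `i·R`").

A **cell symmetry** (`CellSymmetry`) packages a lattice symmetry of the cell grid `ℤ²` together with
its action on the plane: a bijection `cell` of the cells which is an automorphism of `zdGraph 2`, a
bijection `face` of the grid vertices (faces, indexed by lower-left cell), a flag `flip` recording
whether the symmetry exchanges the two diagonal directions NE–SW / NW–SE, and a real-linear
isometry `plane : ℂ ≃ₗᵢ[ℝ] ℂ` with `meshPoint δ (cell x) = plane (meshPoint δ x)`, subject to the
compatibility `cellGraph_adj_cell`: transporting the coins by `face` (and negating them if `flip`)
transports the coin-selected triangulation. Its action on configurations is
`s.act (σ, κ) = (σ ∘ cell⁻¹, flipped κ ∘ face⁻¹)`.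

Main results (all sorry-free):

* transport of G02's discretisation under any cell symmetry: `mem_meshVertices_cell`,
  `meshGraph_adj_cell`, `mem_meshDomain_cell` (the largest-component domain `Ω_δ`),
  `discreteDomainGraph_adj_cell`, `mem_meshBoundary_cell`, `mem_discreteArc_cell` (discrete arcs:
  the isometry preserves `infDist`, the homeomorphism preserves `frontier`);
* **`act_mem_cellCrossing_iff`**: `s.act ω ∈ C_δ(plane Ω; plane A, plane B) ↔ ω ∈ C_δ(Ω; A, B)`,
  and the set form `preimage_act_cellCrossing`;
* the two generators of the dihedral group `D₄` of `δℤ²` fixing the origin: the **quarter turn**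
  `CellSymmetry.rot` (cells `(x₀, x₁) ↦ (-x₁, x₀)`, plane `z ↦ i z`, faces `w ↦ rot w - e₀`, coins
  negated) and the **axis reflection** `CellSymmetry.reflect` (cells `(x₀, x₁) ↦ (x₀, -x₁)`, plane
  `z ↦ conj z`, faces `w ↦ reflect w - e₁`, coins negated), with the corollaries
  `rot_act_mem_cellCrossing_iff` (images under `fun z => Complex.I * z`) and
  `reflect_act_mem_cellCrossing_iff` (images under `starRingEnd ℂ`). Every element of `D₄` is a word
  in these two, and each lemma is an `↔`, so covariance under the whole group follows by rewriting.
* `measurable_act`: the action is measurable (for invariance statements about laws on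
  `CellConfig`, which are not defined in this file);
* conformal rectangles: `cellDomainCrossing R δ = cellCrossing R.carrier δ (R.arc 0) (R.arc 2)`
  (the event whose probability is the route's `ikCrossingProb`, cf. `triDomainCrossingProb`) and
  `rot_act_mem_cellDomainCrossing_iff` for the quarter-turned rectangle
  `R.map (Homeomorph.mulLeft₀ Complex.I _)` — literally the shape of hypothesis (a) of
  `AnchorByRigidity`.

References: S. Smirnov, C. R. Acad. Sci. Paris 333 (2001), §2 (discretisation) [Smirnov2001];
B. Bollobás, O. Riordan, *Percolation* (2006), Ch. 3 ("by symmetry") [BollobasRiordan2006];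
A. Morin-Duchesne, A. Klümper, P. A. Pearce, arXiv:2211.12379, §2.2 [MorinDuchesneKlumperPearce2023].
Template: `PlanarIsingMeshTranslate.lean` (translations). Mathlib: `LinearIsometryEquiv`,
`rotation`, `Circle`, `Complex.conjLIE`, `Homeomorph.image_closure`, `Homeomorph.image_frontier`,
`Metric.infDist_image`, `image_segment`, `SimpleGraph.induceHom`, `SimpleGraph.Iso`.
-/

namespace Literature.Probability.LatticeModels

open _root_.MeasureTheory Percolation

noncomputable section

/-! ### Cell symmetries -/

/-- A symmetry of the cell grid compatible with the plane: a bijection `cell` of the cells that is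
an automorphism of `ℤ²`, a bijection `face` of the grid vertices (faces, by lower-left cell), a
flag `flip` (does the symmetry exchange the NE–SW and NW–SE diagonal directions?), and a linear
isometry `plane` of `ℂ` with `meshPoint δ (cell x) = plane (meshPoint δ x)`, such that transporting
the coins along `face` (negated if `flip`) transports the coin-selected triangulation
(`cellGraph_adj_cell`). The elements of the dihedral group `D₄` of `δℤ²` fixing the origin are
such symmetries (`CellSymmetry.rot`, `CellSymmetry.reflect` generate them).
(Bollobás–Riordan 2006, Ch. 3, lattice symmetries; card `corner-fugacity-plane`.) [folklore] -/
structure CellSymmetry where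
  /-- The action on cells. -/
  cell : Site 2 ≃ Site 2
  /-- The action on grid vertices (faces of `ℤ²`, indexed by lower-left cell). -/
  face : Site 2 ≃ Site 2
  /-- Whether the two diagonal directions are exchanged. -/
  flip : Bool
  /-- The action on the plane. -/
  plane : ℂ ≃ₗᵢ[ℝ] ℂ
  /-- `cell` is an automorphism of the square grid. -/
  zdGraph_adj_cell' : ∀ x y : Site 2, (zdGraph 2).Adj (cell x) (cell y) ↔ (zdGraph 2).Adj x y
  /-- `cell` and `plane` are compatible with the mesh embedding. -/
  meshPoint_cell' : ∀ (δ : ℝ) (x : Site 2), meshPoint δ (cell x) = plane (meshPoint δ x)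
  /-- Transporting the coins transports the triangulation. -/
  cellGraph_adj_cell' : ∀ (κ : Site 2 → Bool) (a b : Site 2),
    (cellGraph fun v => cond flip (!κ (face.symm v)) (κ (face.symm v))).Adj (cell a) (cell b) ↔
      (cellGraph κ).Adj a b

namespace CellSymmetry

variable (s : CellSymmetry) {Ω : Set ℂ} {δ : ℝ}

/-- The transported coins: the coin of the face `face w` is the coin of `w`, negated if the
symmetry exchanges the diagonal directions. [folklore] -/
def coinAct (κ : Site 2 → Bool) : Site 2 → Bool :=
  fun v => cond s.flip (!κ (s.face.symm v)) (κ (s.face.symm v))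

/-- The transported coin at the image face. [folklore] -/
@[simp] theorem coinAct_face (κ : Site 2 → Bool) (w : Site 2) :
    s.coinAct κ (s.face w) = cond s.flip (!κ w) (κ w) := by
  simp [coinAct]

/-- The action on configurations: colours are carried by `cell`, coins by `face` (negated if
`flip`). [folklore] -/
def act (ω : CellConfig) : CellConfig := (fun y => ω.1 (s.cell.symm y), s.coinAct ω.2)

/-- The colour of the image cell is the colour of the cell. [folklore] -/
@[simp] theorem act_fst_cell (ω : CellConfig) (x : Site 2) : (s.act ω).1 (s.cell x) = ω.1 x := by
  simp [act]

/-- The coins of the transported configuration. [folklore] -/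
@[simp] theorem act_snd (ω : CellConfig) : (s.act ω).2 = s.coinAct ω.2 := rfl

/-- The black set of the transported configuration is the image of the black set. [folklore] -/
theorem black_act (ω : CellConfig) : (s.act ω).black = s.cell '' ω.black := by
  ext y
  simp only [CellConfig.mem_black_iff, act, Set.mem_image]
  constructor
  · intro h
    exact ⟨s.cell.symm y, h, s.cell.apply_symm_apply y⟩
  · rintro ⟨x, hx, rfl⟩
    rwa [Equiv.symm_apply_apply]

/-- `cell` is an automorphism of `ℤ²`. [folklore] -/
theorem zdGraph_adj_cell (x y : Site 2) : (zdGraph 2).Adj (s.cell x) (s.cell y) ↔ (zdGraph 2).Adj x y :=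
  s.zdGraph_adj_cell' x y

/-- Compatibility with the mesh embedding. [folklore] -/
theorem meshPoint_cell (δ : ℝ) (x : Site 2) : meshPoint δ (s.cell x) = s.plane (meshPoint δ x) :=
  s.meshPoint_cell' δ x

/-- Transporting the coins transports the triangulation. [folklore] -/
theorem cellGraph_adj_cell (κ : Site 2 → Bool) (a b : Site 2) :
    (cellGraph (s.coinAct κ)).Adj (s.cell a) (s.cell b) ↔ (cellGraph κ).Adj a b :=
  s.cellGraph_adj_cell' κ a b

/-- The action is measurable (each coordinate of the image is a coordinate of the argument, or its
negation). [folklore] -/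
theorem measurable_act : Measurable s.act := by
  refine Measurable.prodMk (measurable_pi_lambda _ fun y => measurable_colour (s.cell.symm y))
    (measurable_pi_lambda _ fun v => ?_)
  change Measurable fun ω : CellConfig => cond s.flip (!ω.2 (s.face.symm v)) (ω.2 (s.face.symm v))
  cases s.flip
  · exact measurable_coin _
  · exact (Measurable.of_discrete (f := fun b : Bool => !b)).comp (measurable_coin _)

/-! ### Transport of the discretisation -/

/-- Closures commute with the plane isometry. [folklore] -/
theorem closure_image_plane (Ω : Set ℂ) : closure (s.plane '' Ω) = s.plane '' closure Ω :=
  (s.plane.toHomeomorph.image_closure Ω).symm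

/-- Frontiers commute with the plane isometry. [folklore] -/
theorem frontier_image_plane (Ω : Set ℂ) : frontier (s.plane '' Ω) = s.plane '' frontier Ω :=
  (s.plane.toHomeomorph.image_frontier Ω).symm

/-- Mesh vertices are transported: `cell x` is a mesh vertex of `plane Ω` iff `x` is one of `Ω`.
[folklore] -/
theorem mem_meshVertices_cell {x : Site 2} :
    s.cell x ∈ meshVertices (s.plane '' Ω) δ ↔ x ∈ meshVertices Ω δ := by
  rw [mem_meshVertices_iff, mem_meshVertices_iff, s.meshPoint_cell, s.plane.injective.mem_set_image]

/-- The closed-segment condition is transported (the isometry is affine and a homeomorphism).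
[folklore] -/
theorem segment_cell_subset_closure_iff {x y : Site 2} :
    segment ℝ (meshPoint δ (s.cell x)) (meshPoint δ (s.cell y)) ⊆ closure (s.plane '' Ω) ↔
      segment ℝ (meshPoint δ x) (meshPoint δ y) ⊆ closure Ω := by
  have hseg : segment ℝ (s.plane (meshPoint δ x)) (s.plane (meshPoint δ y)) =
      s.plane '' segment ℝ (meshPoint δ x) (meshPoint δ y) :=
    (image_segment ℝ s.plane.toLinearEquiv.toLinearMap.toAffineMap (meshPoint δ x)
      (meshPoint δ y)).symm
  rw [s.meshPoint_cell, s.meshPoint_cell, hseg, closure_image_plane,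
    Set.image_subset_image_iff s.plane.injective]

/-- The mesh graph is transported. [folklore] -/
theorem meshGraph_adj_cell {x y : Site 2} :
    (meshGraph (s.plane '' Ω) δ).Adj (s.cell x) (s.cell y) ↔ (meshGraph Ω δ).Adj x y := by
  rw [meshGraph_adj_iff, meshGraph_adj_iff, s.zdGraph_adj_cell, s.segment_cell_subset_closure_iff]

/-- The cell mesh graph is transported (coins transported by `coinAct`). [folklore] -/
theorem cellMeshGraph_adj_cell {κ : Site 2 → Bool} {x y : Site 2} :
    (cellMeshGraph (s.plane '' Ω) δ (s.coinAct κ)).Adj (s.cell x) (s.cell y) ↔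
      (cellMeshGraph Ω δ κ).Adj x y := by
  rw [cellMeshGraph_adj_iff, cellMeshGraph_adj_iff, s.cellGraph_adj_cell,
    s.segment_cell_subset_closure_iff]

/-- The mesh graph of `Ω`, read through the inverse symmetry. [folklore] -/
theorem meshGraph_adj_cell_symm {x y : Site 2} :
    (meshGraph Ω δ).Adj (s.cell.symm x) (s.cell.symm y) ↔ (meshGraph (s.plane '' Ω) δ).Adj x y := by
  rw [← s.meshGraph_adj_cell, Equiv.apply_symm_apply, Equiv.apply_symm_apply]

/-- Mesh vertices of `Ω`, read through the inverse symmetry. [folklore] -/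
theorem mem_meshVertices_cell_symm {x : Site 2} :
    s.cell.symm x ∈ meshVertices Ω δ ↔ x ∈ meshVertices (s.plane '' Ω) δ := by
  rw [← s.mem_meshVertices_cell, Equiv.apply_symm_apply]

/-- The homomorphism of mesh vertex graphs induced by the symmetry. [folklore] -/
def meshVertexHom (Ω : Set ℂ) (δ : ℝ) : meshVertexGraph Ω δ →g meshVertexGraph (s.plane '' Ω) δ :=
  SimpleGraph.induceHom (G' := meshGraph (s.plane '' Ω) δ)
    ⟨s.cell, fun hab => s.meshGraph_adj_cell.2 hab⟩ fun _ hz => s.mem_meshVertices_cell.2 hz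

/-- The homomorphism of mesh vertex graphs induced by the inverse symmetry. [folklore] -/
def meshVertexHomSymm (Ω : Set ℂ) (δ : ℝ) :
    meshVertexGraph (s.plane '' Ω) δ →g meshVertexGraph Ω δ :=
  SimpleGraph.induceHom (G := meshGraph (s.plane '' Ω) δ) (G' := meshGraph Ω δ)
    ⟨s.cell.symm, fun hab => s.meshGraph_adj_cell_symm.2 hab⟩
    fun _ hz => s.mem_meshVertices_cell_symm.2 hz

/-- Reachability in the mesh vertex graph is transported. [folklore] -/
theorem reachable_cell_iff {x y : Site 2} (hx : x ∈ meshVertices Ω δ) (hy : y ∈ meshVertices Ω δ) :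
    (meshVertexGraph (s.plane '' Ω) δ).Reachable ⟨s.cell x, s.mem_meshVertices_cell.2 hx⟩
        ⟨s.cell y, s.mem_meshVertices_cell.2 hy⟩ ↔
      (meshVertexGraph Ω δ).Reachable ⟨x, hx⟩ ⟨y, hy⟩ := by
  constructor
  · intro h
    have h' := h.map (s.meshVertexHomSymm Ω δ)
    have ex : (s.meshVertexHomSymm Ω δ) ⟨s.cell x, s.mem_meshVertices_cell.2 hx⟩ = ⟨x, hx⟩ :=
      Subtype.ext (s.cell.symm_apply_apply x)
    have ey : (s.meshVertexHomSymm Ω δ) ⟨s.cell y, s.mem_meshVertices_cell.2 hy⟩ = ⟨y, hy⟩ :=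
      Subtype.ext (s.cell.symm_apply_apply y)
    rwa [ex, ey] at h'
  · intro h
    exact h.map (s.meshVertexHom Ω δ)

/-- The support of the connected component of a mesh vertex, as a set of sites, is the set of mesh
vertices reachable from it (local copy of the folklore unfolding). [folklore] -/
private theorem mem_image_supp_iff' {Ω : Set ℂ} {δ : ℝ} {x : Site 2} (hx : x ∈ meshVertices Ω δ)
    {z : Site 2} :
    z ∈ Subtype.val '' ((meshVertexGraph Ω δ).connectedComponentMk ⟨x, hx⟩).supp ↔
      ∃ hz : z ∈ meshVertices Ω δ, (meshVertexGraph Ω δ).Reachable ⟨x, hx⟩ ⟨z, hz⟩ := by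
  constructor
  · rintro ⟨⟨z, hz⟩, hmem, rfl⟩
    rw [SimpleGraph.ConnectedComponent.mem_supp_iff, SimpleGraph.ConnectedComponent.eq] at hmem
    exact ⟨hz, hmem.symm⟩
  · rintro ⟨hz, h⟩
    refine ⟨⟨z, hz⟩, ?_, rfl⟩
    rw [SimpleGraph.ConnectedComponent.mem_supp_iff, SimpleGraph.ConnectedComponent.eq]
    exact h.symm

/-- The discrete domain in terms of component sizes (local copy of the folklore unfolding of
`meshDomain`: a mesh vertex whose component has maximal size). [folklore] -/
private theorem mem_meshDomain_iff_ncard' {Ω : Set ℂ} {δ : ℝ} {x : Site 2} :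
    x ∈ meshDomain Ω δ ↔ ∃ hx : x ∈ meshVertices Ω δ, ∀ (y : Site 2) (hy : y ∈ meshVertices Ω δ),
      ((meshVertexGraph Ω δ).connectedComponentMk ⟨y, hy⟩).supp.ncard ≤
        ((meshVertexGraph Ω δ).connectedComponentMk ⟨x, hx⟩).supp.ncard := by
  simp only [meshDomain, Set.mem_iUnion, Set.mem_image, Subtype.exists, exists_and_right,
    exists_eq_right]
  constructor
  · rintro ⟨C, hC, hx, hxC⟩
    refine ⟨hx, fun y hy => ?_⟩
    have hCx : (meshVertexGraph Ω δ).connectedComponentMk ⟨x, hx⟩ = C :=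
      (SimpleGraph.ConnectedComponent.mem_supp_iff _ _).1 hxC
    rw [hCx]
    exact hC _
  · rintro ⟨hx, h⟩
    refine ⟨(meshVertexGraph Ω δ).connectedComponentMk ⟨x, hx⟩, ?_, hx, rfl⟩
    intro C'
    induction C' using SimpleGraph.ConnectedComponent.ind with
    | h y => exact h y y.2

/-- Supports of components are transported: the component of `cell x` in `(plane Ω)_δ` is the image
of the component of `x`. [folklore] -/
theorem image_supp_cell {x : Site 2} (hx : x ∈ meshVertices Ω δ) :
    Subtype.val '' ((meshVertexGraph (s.plane '' Ω) δ).connectedComponentMk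
        ⟨s.cell x, s.mem_meshVertices_cell.2 hx⟩).supp =
      s.cell '' (Subtype.val '' ((meshVertexGraph Ω δ).connectedComponentMk ⟨x, hx⟩).supp) := by
  ext z
  rw [mem_image_supp_iff', Set.mem_image]
  constructor
  · rintro ⟨hz, h⟩
    have hw : s.cell.symm z ∈ meshVertices Ω δ := s.mem_meshVertices_cell_symm.2 hz
    refine ⟨s.cell.symm z, (mem_image_supp_iff' hx).2 ⟨hw, ?_⟩, s.cell.apply_symm_apply z⟩
    have h' := h.map (s.meshVertexHomSymm Ω δ)
    have ex : (s.meshVertexHomSymm Ω δ) ⟨s.cell x, s.mem_meshVertices_cell.2 hx⟩ = ⟨x, hx⟩ :=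
      Subtype.ext (s.cell.symm_apply_apply x)
    have ez : (s.meshVertexHomSymm Ω δ) ⟨z, hz⟩ = ⟨s.cell.symm z, hw⟩ := rfl
    rwa [ex, ez] at h'
  · rintro ⟨w, hw, rfl⟩
    obtain ⟨hw, h⟩ := (mem_image_supp_iff' hx).1 hw
    exact ⟨s.mem_meshVertices_cell.2 hw, (s.reachable_cell_iff hx hw).2 h⟩

/-- Component sizes are invariant under cell symmetries. [folklore] -/
theorem ncard_supp_cell {x : Site 2} (hx : x ∈ meshVertices Ω δ) :
    ((meshVertexGraph (s.plane '' Ω) δ).connectedComponentMk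
        ⟨s.cell x, s.mem_meshVertices_cell.2 hx⟩).supp.ncard =
      ((meshVertexGraph Ω δ).connectedComponentMk ⟨x, hx⟩).supp.ncard := by
  rw [← Set.ncard_image_of_injective _ Subtype.val_injective, s.image_supp_cell hx,
    Set.ncard_image_of_injective _ s.cell.injective,
    Set.ncard_image_of_injective _ Subtype.val_injective]

/-- **The discrete domain is transported:** `cell x ∈ (plane Ω)_δ ↔ x ∈ Ω_δ` (largest connected
component of the square mesh graph; Smirnov 2001, §2). [folklore] -/
theorem mem_meshDomain_cell {x : Site 2} :
    s.cell x ∈ meshDomain (s.plane '' Ω) δ ↔ x ∈ meshDomain Ω δ := by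
  rw [mem_meshDomain_iff_ncard', mem_meshDomain_iff_ncard']
  constructor
  · rintro ⟨hx, h⟩
    refine ⟨s.mem_meshVertices_cell.1 hx, fun y hy => ?_⟩
    have := h (s.cell y) (s.mem_meshVertices_cell.2 hy)
    rwa [s.ncard_supp_cell hy, s.ncard_supp_cell (s.mem_meshVertices_cell.1 hx)] at this
  · rintro ⟨hx, h⟩
    refine ⟨s.mem_meshVertices_cell.2 hx, fun y hy => ?_⟩
    have := h (s.cell.symm y) (s.mem_meshVertices_cell_symm.2 hy)
    rw [s.ncard_supp_cell hx]
    rw [← s.ncard_supp_cell (s.mem_meshVertices_cell_symm.2 hy)] at this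
    convert this using 4
    exact Subtype.ext (s.cell.apply_symm_apply y).symm

/-- The discrete domain of the image is the image of the discrete domain. [folklore] -/
theorem image_cell_meshDomain (Ω : Set ℂ) (δ : ℝ) :
    s.cell '' meshDomain Ω δ = meshDomain (s.plane '' Ω) δ := by
  ext y
  constructor
  · rintro ⟨x, hx, rfl⟩
    exact s.mem_meshDomain_cell.2 hx
  · intro hy
    exact ⟨s.cell.symm y, s.mem_meshDomain_cell.1 (by rwa [Equiv.apply_symm_apply]),
      s.cell.apply_symm_apply y⟩

/-- G02's `Ω_δ` graph is transported. [folklore] -/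
theorem discreteDomainGraph_adj_cell {x y : Site 2} :
    (discreteDomainGraph (s.plane '' Ω) δ).Adj (s.cell x) (s.cell y) ↔
      (discreteDomainGraph Ω δ).Adj x y := by
  rw [discreteDomainGraph_adj_iff, discreteDomainGraph_adj_iff, s.meshGraph_adj_cell,
    s.mem_meshDomain_cell, s.mem_meshDomain_cell]

/-- The cell `Ω_δ` graph is transported (coins transported by `coinAct`). [folklore] -/
theorem cellDomainGraph_adj_cell {κ : Site 2 → Bool} {x y : Site 2} :
    (cellDomainGraph (s.plane '' Ω) δ (s.coinAct κ)).Adj (s.cell x) (s.cell y) ↔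
      (cellDomainGraph Ω δ κ).Adj x y := by
  rw [cellDomainGraph_adj_iff, cellDomainGraph_adj_iff, s.cellMeshGraph_adj_cell,
    s.mem_meshDomain_cell, s.mem_meshDomain_cell]

/-- **The discrete boundary is transported.** [folklore] -/
theorem mem_meshBoundary_cell {x : Site 2} :
    s.cell x ∈ meshBoundary (s.plane '' Ω) δ ↔ x ∈ meshBoundary Ω δ := by
  rw [mem_meshBoundary_iff, mem_meshBoundary_iff, s.mem_meshDomain_cell]
  refine and_congr_right fun _ => ⟨?_, ?_⟩
  · rintro ⟨y, hy, hn⟩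
    refine ⟨s.cell.symm y, ?_, fun h => hn ?_⟩
    · rwa [← s.zdGraph_adj_cell, Equiv.apply_symm_apply]
    · rwa [← s.discreteDomainGraph_adj_cell, Equiv.apply_symm_apply] at h
  · rintro ⟨y, hy, hn⟩
    exact ⟨s.cell y, (s.zdGraph_adj_cell x y).2 hy, fun h => hn (s.discreteDomainGraph_adj_cell.1 h)⟩

/-- **Discrete arcs are transported:** the isometry preserves the distances to `A` and to
`∂Ω ∖ A` that select the discrete arc (Smirnov 2001, §2). [folklore] -/
theorem mem_discreteArc_cell {A : Set ℂ} {x : Site 2} :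
    s.cell x ∈ discreteArc (s.plane '' Ω) δ (s.plane '' A) ↔ x ∈ discreteArc Ω δ A := by
  rw [mem_discreteArc_iff, mem_discreteArc_iff, s.mem_meshBoundary_cell, s.meshPoint_cell,
    s.frontier_image_plane, ← Set.image_sdiff s.plane.injective,
    Metric.infDist_image s.plane.isometry, Metric.infDist_image s.plane.isometry]

/-- The discrete arc of the image is the image of the discrete arc. [folklore] -/
theorem image_cell_discreteArc (Ω : Set ℂ) (δ : ℝ) (A : Set ℂ) :
    s.cell '' discreteArc Ω δ A = discreteArc (s.plane '' Ω) δ (s.plane '' A) := by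
  ext y
  constructor
  · rintro ⟨x, hx, rfl⟩
    exact s.mem_discreteArc_cell.2 hx
  · intro hy
    exact ⟨s.cell.symm y, s.mem_discreteArc_cell.1 (by rwa [Equiv.apply_symm_apply]),
      s.cell.apply_symm_apply y⟩

/-! ### Covariance of the crossing event -/

/-- The symmetry as an isomorphism between the cell `Ω_δ` graphs of `ω` and of `s.act ω`.
[folklore] -/
def domainIso (Ω : Set ℂ) (δ : ℝ) (ω : CellConfig) :
    cellDomainGraph Ω δ ω.2 ≃g cellDomainGraph (s.plane '' Ω) δ (s.act ω).2 where
  toEquiv := s.cell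
  map_rel_iff' := s.cellDomainGraph_adj_cell

/-- **`D₄`-covariance of the cell crossing event** (for any cell symmetry `s`): the transported
configuration crosses the transported conformal rectangle iff the configuration crosses the
original one, `s.act ω ∈ C_δ(plane Ω; plane A, plane B) ↔ ω ∈ C_δ(Ω; A, B)` — same mesh `δ`,
because `plane` fixes the origin and maps `δℤ²` to itself. (Smirnov 2001, §2; Bollobás–Riordan 2006,
Ch. 3, "by symmetry"; hypothesis (a) of `AnchorByRigidity`, route CardyIKTransport.) [folklore] -/
theorem act_mem_cellCrossing_iff (ω : CellConfig) (Ω : Set ℂ) (δ : ℝ) (A B : Set ℂ) :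
    s.act ω ∈ cellCrossing (s.plane '' Ω) δ (s.plane '' A) (s.plane '' B) ↔
      ω ∈ cellCrossing Ω δ A B := by
  rw [mem_cellCrossing_iff, mem_cellCrossing_iff, ← s.image_cell_discreteArc,
    ← s.image_cell_discreteArc, s.black_act, ← s.image_cell_meshDomain]
  constructor
  · rintro ⟨_, ⟨x, hx, rfl⟩, _, ⟨y, hy, rfl⟩, h⟩
    refine ⟨x, hx, y, hy, ?_⟩
    have key := relabel_mem_siteConnIn_iff (s.domainIso Ω δ ω) ω.black (meshDomain Ω δ) x y
    rw [SiteConfig.relabel_apply] at key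
    exact key.1 h
  · rintro ⟨x, hx, y, hy, h⟩
    refine ⟨s.cell x, ⟨x, hx, rfl⟩, s.cell y, ⟨y, hy, rfl⟩, ?_⟩
    have key := relabel_mem_siteConnIn_iff (s.domainIso Ω δ ω) ω.black (meshDomain Ω δ) x y
    rw [SiteConfig.relabel_apply] at key
    exact key.2 h

/-- Set form of the covariance: the crossing event of the transported conformal rectangle pulls
back along the action to the crossing event. [folklore] -/
theorem preimage_act_cellCrossing (Ω : Set ℂ) (δ : ℝ) (A B : Set ℂ) :
    s.act ⁻¹' cellCrossing (s.plane '' Ω) δ (s.plane '' A) (s.plane '' B) = cellCrossing Ω δ A B :=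
  Set.ext fun ω => s.act_mem_cellCrossing_iff ω Ω δ A B

end CellSymmetry

/-! ### The quarter turn and the axis reflection -/

/-- Adjacency of `ℤ²` in coordinates (local copy of the folklore characterisation). [folklore] -/
private theorem zd2_adj_coord' (x y : Site 2) :
    (zdGraph 2).Adj x y ↔
      ((y 0 = x 0 + 1 ∨ x 0 = y 0 + 1) ∧ y 1 = x 1) ∨
        ((y 1 = x 1 + 1 ∨ x 1 = y 1 + 1) ∧ y 0 = x 0) := by
  rw [zdGraph_adj_iff, Fin.exists_fin_two]
  simp only [funext_iff, Fin.forall_fin_two, Pi.add_apply, Pi.single_eq_same,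
    Pi.single_eq_of_ne (one_ne_zero : (1 : Fin 2) ≠ 0),
    Pi.single_eq_of_ne (zero_ne_one : (0 : Fin 2) ≠ 1), add_zero]
  omega

/-- The quarter turn `(x₀, x₁) ↦ (-x₁, x₀)` of `ℤ²` (rotation by `+90°` about the origin), with
inverse `(x₀, x₁) ↦ (x₁, -x₀)`. [folklore] -/
def rotCell : Site 2 ≃ Site 2 where
  toFun x := ![-x 1, x 0]
  invFun x := ![x 1, -x 0]
  left_inv x := by ext i; fin_cases i <;> simp
  right_inv x := by ext i; fin_cases i <;> simp

/-- `rotCell` in coordinates. [folklore] -/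
@[simp] theorem rotCell_apply_zero (x : Site 2) : rotCell x 0 = -x 1 := rfl

/-- `rotCell` in coordinates. [folklore] -/
@[simp] theorem rotCell_apply_one (x : Site 2) : rotCell x 1 = x 0 := rfl

/-- `rotCell⁻¹` in coordinates. [folklore] -/
@[simp] theorem rotCell_symm_apply_zero (x : Site 2) : rotCell.symm x 0 = x 1 := rfl

/-- `rotCell⁻¹` in coordinates. [folklore] -/
@[simp] theorem rotCell_symm_apply_one (x : Site 2) : rotCell.symm x 1 = -x 0 := rfl

/-- The unit complex number `i` as an element of the circle group. [folklore] -/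
def circleI : Circle := ⟨Complex.I, mem_sphere_zero_iff_norm.2 (by simp)⟩

/-- `circleI` is `i`. [folklore] -/
@[simp] theorem coe_circleI : (circleI : ℂ) = Complex.I := rfl

/-- **The quarter turn as a cell symmetry:** cells `(x₀, x₁) ↦ (-x₁, x₀)`, plane `z ↦ i z`
(Mathlib's `rotation`), faces `w ↦ rotCell w - e₀` (the face with corners `w, w + e₀, w + e₁,
w + 1` is carried to the face with lower-left cell `rotCell w - e₀`), coins negated (a quarter turn
exchanges the NE–SW and NW–SE directions). (Card `corner-fugacity-plane`: exact `D₄`-symmetry of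
the fair-coin model; route CardyIKTransport, `AnchorByRigidity` (a).) [folklore] -/
def CellSymmetry.rot : CellSymmetry where
  cell := rotCell
  face := rotCell.trans (Equiv.addRight (-(Pi.single 0 1 : Site 2)))
  flip := true
  plane := rotation circleI
  zdGraph_adj_cell' x y := by
    rw [zd2_adj_coord', zd2_adj_coord']
    simp only [rotCell_apply_zero, rotCell_apply_one]
    omega
  meshPoint_cell' δ x := by
    apply Complex.ext <;> simp [rotation_apply, meshPoint, Site.toComplex]
  cellGraph_adj_cell' κ a b := by
    rw [cellGraph_adj_iff_exists_face, cellGraph_adj_iff_exists_face]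
    refine or_congr ?_ ?_
    · rw [zd2_adj_coord', zd2_adj_coord']
      simp only [rotCell_apply_zero, rotCell_apply_one]
      omega
    · rw [(rotCell.trans (Equiv.addRight (-(Pi.single 0 1 : Site 2)))).surjective.exists]
      refine exists_congr fun w => ?_
      simp only [Equiv.symm_apply_apply, cond_true, Bool.not_eq_true', Bool.not_eq_false']
      simp only [Equiv.trans_apply, Equiv.coe_addRight, funext_iff, Fin.forall_fin_two, Pi.add_apply,
        Pi.neg_apply, Pi.one_apply, rotCell_apply_zero, rotCell_apply_one, Pi.single_eq_same,
        Pi.single_eq_of_ne (one_ne_zero : (1 : Fin 2) ≠ 0),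
        Pi.single_eq_of_ne (zero_ne_one : (0 : Fin 2) ≠ 1)]
      cases κ w <;> simp <;> omega

/-- **The axis reflection as a cell symmetry:** cells `(x₀, x₁) ↦ (x₀, -x₁)` (`cellReflect`),
plane `z ↦ conj z` (Mathlib's `Complex.conjLIE`), faces `w ↦ cellReflect w - e₁`, coins negated
(a reflection in an axis exchanges the two diagonal directions). (Card `corner-fugacity-plane`:
exact `D₄`-symmetry of the fair-coin model.) [folklore] -/
def CellSymmetry.reflect : CellSymmetry where
  cell := cellReflect
  face := cellReflect.trans (Equiv.addRight (-(Pi.single 1 1 : Site 2)))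
  flip := true
  plane := Complex.conjLIE
  zdGraph_adj_cell' x y := by
    rw [zd2_adj_coord', zd2_adj_coord']
    simp only [cellReflect_apply_zero, cellReflect_apply_one]
    omega
  meshPoint_cell' δ x := by
    apply Complex.ext <;> simp [meshPoint, Site.toComplex]
  cellGraph_adj_cell' κ a b := by
    rw [cellGraph_adj_iff_exists_face, cellGraph_adj_iff_exists_face]
    refine or_congr ?_ ?_
    · rw [zd2_adj_coord', zd2_adj_coord']
      simp only [cellReflect_apply_zero, cellReflect_apply_one]
      omega
    · rw [(cellReflect.trans (Equiv.addRight (-(Pi.single 1 1 : Site 2)))).surjective.exists]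
      refine exists_congr fun w => ?_
      simp only [Equiv.symm_apply_apply, cond_true, Bool.not_eq_true', Bool.not_eq_false']
      simp only [Equiv.trans_apply, Equiv.coe_addRight, funext_iff, Fin.forall_fin_two, Pi.add_apply,
        Pi.neg_apply, Pi.one_apply, cellReflect_apply_zero, cellReflect_apply_one,
        Pi.single_eq_same, Pi.single_eq_of_ne (one_ne_zero : (1 : Fin 2) ≠ 0),
        Pi.single_eq_of_ne (zero_ne_one : (0 : Fin 2) ≠ 1)]
      cases κ w <;> simp <;> omega

/-- The plane action of the quarter turn is multiplication by `i`. [folklore] -/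
@[simp] theorem CellSymmetry.rot_plane_apply (z : ℂ) : CellSymmetry.rot.plane z = Complex.I * z := by
  simp [CellSymmetry.rot, rotation_apply]

/-- The plane action of the reflection is complex conjugation. [folklore] -/
@[simp] theorem CellSymmetry.reflect_plane_apply (z : ℂ) :
    CellSymmetry.reflect.plane z = (starRingEnd ℂ) z := by
  simp [CellSymmetry.reflect]

/-- Images under the quarter turn's plane action are images under `z ↦ i z`. [folklore] -/
theorem CellSymmetry.image_rot_plane (S : Set ℂ) :
    CellSymmetry.rot.plane '' S = (fun z => Complex.I * z) '' S :=
  Set.image_congr fun z _ => CellSymmetry.rot_plane_apply z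

/-- Images under the reflection's plane action are images under `conj`. [folklore] -/
theorem CellSymmetry.image_reflect_plane (S : Set ℂ) :
    CellSymmetry.reflect.plane '' S = (starRingEnd ℂ) '' S :=
  Set.image_congr fun z _ => CellSymmetry.reflect_plane_apply z

/-- **Quarter-turn covariance of the cell crossing event:** the rotated configuration crosses the
rotated conformal rectangle `(iΩ; iA, iB)` at mesh `δ` iff the configuration crosses `(Ω; A, B)` at
mesh `δ`. (Route CardyIKTransport, hypothesis (a) of `AnchorByRigidity`; card
`corner-fugacity-plane`, "exact `D₄`".) [folklore] -/
theorem rot_act_mem_cellCrossing_iff (ω : CellConfig) (Ω : Set ℂ) (δ : ℝ) (A B : Set ℂ) :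
    CellSymmetry.rot.act ω ∈ cellCrossing ((fun z => Complex.I * z) '' Ω) δ
        ((fun z => Complex.I * z) '' A) ((fun z => Complex.I * z) '' B) ↔
      ω ∈ cellCrossing Ω δ A B := by
  rw [← CellSymmetry.image_rot_plane, ← CellSymmetry.image_rot_plane,
    ← CellSymmetry.image_rot_plane]
  exact CellSymmetry.rot.act_mem_cellCrossing_iff ω Ω δ A B

/-- **Reflection covariance of the cell crossing event** (reflection in the real axis).
(Card `corner-fugacity-plane`, "exact `D₄`"; Bollobás–Riordan 2006, Ch. 3, "reflected
horizontally".) [folklore] -/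
theorem reflect_act_mem_cellCrossing_iff (ω : CellConfig) (Ω : Set ℂ) (δ : ℝ) (A B : Set ℂ) :
    CellSymmetry.reflect.act ω ∈ cellCrossing ((starRingEnd ℂ) '' Ω) δ ((starRingEnd ℂ) '' A)
        ((starRingEnd ℂ) '' B) ↔
      ω ∈ cellCrossing Ω δ A B := by
  rw [← CellSymmetry.image_reflect_plane, ← CellSymmetry.image_reflect_plane,
    ← CellSymmetry.image_reflect_plane]
  exact CellSymmetry.reflect.act_mem_cellCrossing_iff ω Ω δ A B

/-- Set form of the quarter-turn covariance. [folklore] -/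
theorem preimage_rot_act_cellCrossing (Ω : Set ℂ) (δ : ℝ) (A B : Set ℂ) :
    CellSymmetry.rot.act ⁻¹' cellCrossing ((fun z => Complex.I * z) '' Ω) δ
        ((fun z => Complex.I * z) '' A) ((fun z => Complex.I * z) '' B) =
      cellCrossing Ω δ A B :=
  Set.ext fun ω => rot_act_mem_cellCrossing_iff ω Ω δ A B

/-! ### Conformal rectangles -/

/-- The cell crossing event of a conformal rectangle `R = (Ω; a, b, c, d)` at mesh `δ`: a black
crossing of `Ω_δ` from the discrete arc of `(ab) = R.arc 0` to that of `(cd) = R.arc 2` (as for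
`bondDomainCrossingProb` / `triDomainCrossingProb` of `CardyFormula.lean`). Its probability under the
Izergin–Korepin / corner-fugacity laws is the route's `ikCrossingProb` (definition request
`defn-CornerFugacityMeasure`). (Smirnov 2001, §2; route CardyIKTransport.) [cite: Smirnov2001, §2] -/
def cellDomainCrossing (R : RandomPlanarGeometry.ConformalRectangle) (δ : ℝ) : Set CellConfig :=
  cellCrossing R.carrier δ (R.arc 0) (R.arc 2)

/-- The conformal-rectangle crossing event is measurable. [folklore] -/
theorem measurableSet_cellDomainCrossing (R : RandomPlanarGeometry.ConformalRectangle) (δ : ℝ) :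
    MeasurableSet (cellDomainCrossing R δ) :=
  measurableSet_cellCrossing _ _ _ _

/-- **Quarter-turn covariance for conformal rectangles:** the rotated configuration crosses the
quarter-turned rectangle `i·R = R.map (z ↦ i z)` at mesh `δ` iff the configuration crosses `R` at
mesh `δ` — the shape of hypothesis (a) of `AnchorByRigidity` (route CardyIKTransport), for the
event underlying `ikCrossingProb`. [folklore] -/
theorem rot_act_mem_cellDomainCrossing_iff (ω : CellConfig)
    (R : RandomPlanarGeometry.ConformalRectangle) (δ : ℝ) :
    CellSymmetry.rot.act ω ∈
        cellDomainCrossing (R.map (Homeomorph.mulLeft₀ Complex.I Complex.I_ne_zero)) δ ↔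
      ω ∈ cellDomainCrossing R δ := by
  simp only [cellDomainCrossing, RandomPlanarGeometry.MarkedDomain.carrier_map,
    RandomPlanarGeometry.MarkedDomain.arc_map, Homeomorph.coe_mulLeft₀]
  exact rot_act_mem_cellCrossing_iff ω R.carrier δ (R.arc 0) (R.arc 2)

/-- Set form: the crossing event of the quarter-turned rectangle pulls back to the crossing event of
the rectangle along the rotation of configurations. [folklore] -/
theorem preimage_rot_act_cellDomainCrossing (R : RandomPlanarGeometry.ConformalRectangle) (δ : ℝ) :
    CellSymmetry.rot.act ⁻¹'
        cellDomainCrossing (R.map (Homeomorph.mulLeft₀ Complex.I Complex.I_ne_zero)) δ =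
      cellDomainCrossing R δ :=
  Set.ext fun ω => rot_act_mem_cellDomainCrossing_iff ω R δ

end

end Literature.Probability.LatticeModels
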